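import Summits.AtomisticToContinuum.Crystallization.Theorems.FrustratedLawDichotomyStrainedPatchHomValueT2KitW

/-!
# G5′ TRACK edition: the centred second-order value leaf AT THE AFFINE SHUFFLE TRACK, and the centred slope enclosure at the track
# (27623 `(H) HomFloor`, hcp half, E-piece NEAR boxes; decomp-a2c hand-1 g48 — critic rows 1654 (S4) «NEAR-GATE-106» columns (a) joint/centred and
# (b) `G_enc`, 1655 / 1659 (C) item 5; consumer shape = `…HomSignedWell.hcpEnergy_of_ballLeaves_signed` (`hval`, `hslope` AT the track `σ U`))

THE TRACK.  A `U`-box `|U_ab − c_ab/SC| ≤ w_ab/SC` (symmetric centre, read through the six folded entry variables `t_e`, `e ↦ (0,0),(1,1),(2,2),(0,1),(0,2),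
(1,2)` = the folded coordinates `0 … 5` of `…HomValueT2Kit`), a shuffle centre `η_c = c (inr ·)/SC` and a per-frame `3 × 6` integer matrix `aP`
(`A_me = aP m e / SC`; in production `A = dξ̂/dU` at the frame centre, census `frames49.json`).  The affine track is `σ(U) = η_c + A·t`, and the near design of
record certifies the energy on the tube ball around `σ(U)` from THREE LEAVES AT THE TRACK (`hval`, `hslope`, `hcurv` of `hcpEnergy_of_ballLeaves_signed`).

§13 THE VALUE LEAF AT THE TRACK (`t2ReportT`) = the landed JOINT-SEGMENT leaf (`t2ReportJ`, Design J of `…HomValueT2KitL` §12) RESTRICTED TO THE GRAPH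
`δ = (t, A t)` of the track inside the product box `P = (U-box) × (η_c ± dW)`, `dW_m = ⌈Σ_e |A_me| w_e⌉` (the track range):
 * the segment from the centre `x_c = (U_c, η_c)` to `x = (U, σ U)` lies on the graph and inside `P`, so Design J's inequality
   `E(x) ≥ V₀ + g·δ + ½ δᵀH^cδ − (1/6)Σ Λ_abm|δ_aδ_bδ_m| − ½ Σ rad0_ab|δ_aδ_b|` (point gradient/Hessian `g, H^c` with their point widths, full-box third-derivative
   hulls `Λ`, value-hull radii `rad0`) applies at `x` with `|δ_e| ≤ w_e` (`e < 6`) and `|δ_{6+m}| ≤ dW_m`;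
 * on the graph the quadratic model is a quadratic in the SIX entry variables: `g̃ = g_U + Aᵀ g_ξ`, `H̃ = H_UU + H_Uξ A + AᵀH_ξU + AᵀH_ξξ A` (interval
   arithmetic on the point data, then centre/radius split: the radii are the point-width penalty `penP`), minimised over `|t_e| ≤ w_e` by the landed
   anchor/PSD-shift `boxMin` (the three `ξ` coordinates carry width `0`);
 * `LB = V₀ + boxMin₆ − penP − penJ − pen0 ≤ min_{U ∈ box} E(U, σ U)` — the `hval` input with `σ` = the affine track (no frozen reference, no drift radius).
§14 THE SLOPE ENCLOSURE AT THE TRACK (`t2SlopeT`): `∂E/∂ξ_i (U, σ U) = g_{6+i}(x_c) + ∫₀¹ Σ_k H_{6+i,k}(x_c + sδ) δ_k ds` and on the graph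
`Σ_k H_{6+i,k} δ_k = Σ_e J_{ie} t_e`, `J_{ie} = H_{6+i,e} + Σ_m H_{6+i,6+m} A_me ∈` the full-box VALUE HULL of the `B`-family Hessian rows combined with `A`
(the centre value of `J` vanishes when `A = dξ̂/dU`, so the enclosure is second order in the box size); `G_i := |g_{6+i}(x_c)|↑ + Σ_e |J_{ie}|↑ w_e`
bounds `|∂E/∂ξ_i|` on the whole `U`-box at the track, and `|Σ_b segG W′ p_b(U,σU) (U(ξ − σU)) 0| = |⟨∇_ξE, ξ − σU⟩| ≤ ‖G‖₂ ‖ξ − σU‖ ≤ (4/3)‖G‖₂ ‖U(ξ − σU)‖`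
(`‖U − 1‖ ≤ 1/4`) is the `hslope` input.

DEFINITIONS ONLY (computable, outward-rounded `FI` arithmetic; tree imports only); the soundness theorems (`t2ReportT_sound` = Design J's segment
inequality on the graph + the algebra of the restriction; `t2SlopeT_sound` = the mean-value form above) are the (I1)-type debts of this edition and are
NOT claimed here.  0 sorry; no instances / notation / `#eval`.  `--supports stmt-AtomisticToContinuum-27623`.
-/

namespace Summit.AtomisticToContinuum.Crystallization.Theorems.FrustratedLawDichotomyStrainedPatchHomValueT2Kit

open Literature.Analysis.ValidatedNumerics.Numerics
open Summit.AtomisticToContinuum.Crystallization.Theorems.FrustratedLawDichotomyStrainedPatchHomEntryGram (cen rad)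
open Summit.AtomisticToContinuum.Crystallization.Theorems.FrustratedLawDichotomyStrainedPatchHomEntryGramHcp (shufFI)
open Summit.AtomisticToContinuum.Crystallization.Theorems.FrustratedLawDichotomyStrainedPatchHomCurvCentreKit (boxE cenE cenX)

/-! ## §13. The track box, the graph restriction, the value report at the track -/

/-- The track matrix entry `A_me = aP m e / SC` as a thin interval. -/
def aFI (aP : Fin 3 → Fin 6 → ℤ) (m : ℕ) (e : ℕ) : FI :=
  if hm : m < 3 then (if he : e < 6 then thin (aP ⟨m, hm⟩ ⟨e, he⟩) else fi0) else fi0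

/-- ★ Drift half-width of the track range in the shuffle coordinate `m` (SC units, rounded up, at least `1`): `dW_m = ⌈Σ_e |aP m e|·w_e / SC⌉ ⊔ 1`,
`w_e` = the folded entry half-widths of the `U`-box. -/
def driftW (aP : Fin 3 → Fin 6 → ℤ) (w : (Fin 3 × Fin 3) ⊕ Fin 3 → ℤ) (m : Fin 3) : ℤ :=
  max 1 (cdiv ((List.range 6).foldl (fun s e =>
    if he : e < 6 then s + |aP m ⟨e, he⟩| * foldW w ⟨e, by omega⟩ else s) 0) (SC : ℤ))

/-- ★ The half-widths of the TRACK PRODUCT BOX: entries unchanged, shuffle half-width `w (inr m) + dW_m` (the given shuffle half-width is extra slack,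
`0` in production). -/
def trackW (aP : Fin 3 → Fin 6 → ℤ) (w : (Fin 3 × Fin 3) ⊕ Fin 3 → ℤ) : (Fin 3 × Fin 3) ⊕ Fin 3 → ℤ := fun k =>
  match k with
  | Sum.inl ab => w (Sum.inl ab)
  | Sum.inr m => w (Sum.inr m) + driftW aP w m

/-- ★ The gradient of the quadratic model RESTRICTED TO THE GRAPH: `g̃_e = g_e + Σ_m A_me g_{6+m}` (`e < 6`), `0` on the `ξ` slots. -/
def gradTrack (aP : Fin 3 → Fin 6 → ℤ) (g : Array FI) : Array FI :=
  Array.ofFn fun n : Fin 9 =>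
    if n.val < 6 then
      (List.range 3).foldl (fun s m => s.add ((aFI aP m n.val).mul (g.getD (6 + m) fi0))) (g.getD n.val fi0)
    else fi0

/-- ★ The Hessian of the quadratic model RESTRICTED TO THE GRAPH (`9 × 9` row-major, `ξ` rows/columns zero):
`H̃_{ee'} = H_{ee'} + Σ_m (H_{e,6+m} A_{me'} + A_{me} H_{6+m,e'}) + Σ_{m,m'} A_{me} A_{m'e'} H_{6+m,6+m'}`. -/
def hessTrack (aP : Fin 3 → Fin 6 → ℤ) (H : Array FI) : Array FI :=
  Array.ofFn fun n : Fin 81 =>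
    let e := n.val / 9
    let e' := n.val % 9
    if e < 6 ∧ e' < 6 then
      let Hg := fun (k l : ℕ) => H.getD (9 * k + l) fi0
      (List.range 3).foldl (fun s m =>
        let s1 := (s.add ((Hg e (6 + m)).mul (aFI aP m e'))).add ((aFI aP m e).mul (Hg (6 + m) e'))
        (List.range 3).foldl (fun s2 m' => s2.add (((aFI aP m e).mul (aFI aP m' e')).mul (Hg (6 + m) (6 + m')))) s1) (Hg e e')
    else fi0

/-- The folded half-widths with the three `ξ` slots zeroed (the graph has no free shuffle coordinate). -/
def wfU (wf : Array ℤ) : Array ℤ := Array.ofFn fun p : Fin 9 => if p.val < 6 then wf.getD p.val 0 else 0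

/-- The track report given the centre value option `vo` (shared by the fixed-window and the windowed editions). -/
def t2TrackCore (vo : Option ℤ) (μ : ℤ) (c w : (Fin 3 × Fin 3) ⊕ Fin 3 → ℤ) (aP : Fin 3 → Fin 6 → ℤ) : Bool × ℤ × ℤ × ℤ × ℤ × ℤ × ℤ × ℤ :=
  let w' := trackW aP w
  let LA := nearA c w'
  let LB := nearB c w'
  let wf : Array ℤ := Array.ofFn fun p : Fin 9 => foldW w' p
  let wu := wfU wf
  let P := passP c LA LB
  let A := passJ c w' wf LA LB
  let HT := hessTrack aP P.H
  let gT := gradTrack aP P.g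
  let Hc : Array ℤ := HT.map cen
  let Hr : Array ℤ := HT.map rad
  let gc : Array ℤ := gT.map cen
  let gr : Array ℤ := gT.map rad
  match vo, kappaShift Hc with
  | some v, some κ =>
    let t := anchor Hc gc wu 40
    let bm := boxMin Hc gc wu κ t
    let pP : ℤ := cdiv ((List.range 9).foldl (fun s k => s + gr.getD k 0 * wu.getD k 0) 0) (SC : ℤ) +
      cdiv ((List.range 9).foldl (fun s k => (List.range 9).foldl (fun s2 l => s2 + (Hr.getD (9 * k + l) 0) * wu.getD k 0 * wu.getD l 0) s) 0)
        (2 * (SC : ℤ) * (SC : ℤ))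
    let pL : ℤ := cdiv A.pen6 (6 * (SC : ℤ) * (SC : ℤ))
    let p0 : ℤ := cdiv A.pen0 (2 * (SC : ℤ) * (SC : ℤ))
    (foldGuard c w' && P.ok && A.ok && symOK Hc, v - μ, bm, pP, pL, p0, κ, v + bm - pP - pL - p0 - μ)
  | some v, none => (false, v - μ, 0, 0, 0, 0, -1, 0)
  | none, _ => (false, 0, 0, 0, 0, 0, 0, 0)

/-- ★★ **THE TRACK REPORT** `t2ReportT μ c w aP = (flag, V₀ − μ, boxMin₆, penP̃, penJ, pen0, κ, LB − μ)` in `SC` units (`/2SC` = surplus units):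
`LB − μ = V₀ + boxMin₆(H̃^c, g̃^c; w_U) − penP̃ − penJ − pen0 − μ`, the certified floor of `E(U, σ U) − μ/SC` over the `U`-box `(c, w)` at the affine track
`σ U = η_c + A·δU` (`η_c = c (inr ·)/SC`); `penJ`, `pen0` are Design J's penalties on the track product box; `flag` as in `t2ReportJ` on that box; `V₀` from the
landed `valueP` (window `2⁴⁴`). -/
def t2ReportT (μ : ℤ) (c w : (Fin 3 × Fin 3) ⊕ Fin 3 → ℤ) (aP : Fin 3 → Fin 6 → ℤ) : Bool × ℤ × ℤ × ℤ × ℤ × ℤ × ℤ × ℤ :=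
  t2TrackCore (valueP μ c) μ c w aP

/-- ★★ **THE TRACK REPORT, windowed value edition** (`valuePW win n` of `…HomValueT2KitW` in place of `valueP`). -/
def t2ReportTW (win : ℤ) (n : ℕ) (μ : ℤ) (c w : (Fin 3 × Fin 3) ⊕ Fin 3 → ℤ) (aP : Fin 3 → Fin 6 → ℤ) : Bool × ℤ × ℤ × ℤ × ℤ × ℤ × ℤ × ℤ :=
  t2TrackCore (valuePW win n μ c) μ c w aP

/-- ★★★ **THE TRACK VERDICT** `valueLeafT2T μ c w aP`: flag ∧ `0 ≤ LB − μ`. -/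
def valueLeafT2T (μ : ℤ) (c w : (Fin 3 × Fin 3) ⊕ Fin 3 → ℤ) (aP : Fin 3 → Fin 6 → ℤ) : Bool :=
  let r := t2ReportT μ c w aP
  r.1 && decide (0 ≤ r.2.2.2.2.2.2.2)

/-! ## §14. The centred slope enclosure at the track -/

/-- ★ The full-box VALUE HULL of the `B`-family Hessian (folded `9 × 9`, summed over the labels; the `A` family does not depend on `ξ`) over the track
product box `(c, w')`; guard `false` iff a label fails to dispatch. -/
def hessBoxB (c w' : (Fin 3 × Fin 3) ⊕ Fin 3 → ℤ) (LB : List (Fin 3 → ℤ)) : Acc :=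
  let EF := boxE c w'
  let XF := shufFI c w'
  LB.foldl (fun A b =>
    match mkDRec 9 EF (qB XF b) with
    | none => ⟨false, A.arr⟩
    | some R => ⟨A.ok, addArr 81 A.arr (hessOf R false)⟩) ⟨true, zeroArr 81⟩

/-- ★ The track Jacobian hull of the shuffle gradient: `J_{ie} = H_{6+i,e} + Σ_m H_{6+i,6+m}·A_me` (`i < 3`, `e < 6`) from a `9 × 9` interval Hessian. -/
def jacTrack (aP : Fin 3 → Fin 6 → ℤ) (H : Array FI) (i e : ℕ) : FI :=
  let Hg := fun (k l : ℕ) => H.getD (9 * k + l) fi0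
  (List.range 3).foldl (fun s m => s.add ((Hg (6 + i) (6 + m)).mul (aFI aP m e))) (Hg (6 + i) e)

/-- ★★ **THE SLOPE REPORT AT THE TRACK** `t2SlopeT c w aP = (flag, G₀, G₁, G₂, g₀, g₁, g₂)` in `SC` units: `G_i = |g_{6+i}(x_c)|↑ + ⌈Σ_e |J_{ie}|↑·w_e / SC⌉`
bounds `|∂E/∂ξ_i (U, σ U)|·SC` over the `U`-box `(c, w)` at the affine track; `g_i = |g_{6+i}(x_c)|↑` (the point part, for the table); `flag` = every label of
both near lists dispatched at the point and on the box. -/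
def t2SlopeT (c w : (Fin 3 × Fin 3) ⊕ Fin 3 → ℤ) (aP : Fin 3 → Fin 6 → ℤ) : Bool × ℤ × ℤ × ℤ × ℤ × ℤ × ℤ :=
  let w' := trackW aP w
  let LA := nearA c w'
  let LB := nearB c w'
  let wf : Array ℤ := Array.ofFn fun p : Fin 9 => foldW w' p
  let P := passP c LA LB
  let B := hessBoxB c w' LB
  let gpt := fun (i : ℕ) => (P.g.getD (6 + i) fi0).absHi
  let G := fun (i : ℕ) =>
    gpt i + cdiv ((List.range 6).foldl (fun s e => s + (jacTrack aP B.arr i e).absHi * wf.getD e 0) 0) (SC : ℤ)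
  (P.ok && B.ok, G 0, G 1, G 2, gpt 0, gpt 1, gpt 2)

/-! ## §14b. The SECOND-ORDER centred slope enclosure at the track, in `y`-space (no `U⁻ᵀ` factor)

The slope hypothesis of `hcpEnergy_of_ballLeaves_signed` reads `|Σ_b segG W′ p_b (U(ξ − σU)) 0| ≤ G‖U(ξ − σU)‖`, and `Σ_b segG W′ p_b Δ 0 = ⟨F, Δ⟩` with the
`y`-SPACE shuffle force `F_a = Σ_{b ∈ B} β_b y_{b,a}` (`β = W′/ρ`, `y_b = U(p_b + s + ξ)`), so `G := sup_box ‖F(U, σU)‖₂` is admissible WITHOUT the `4/3`.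
Per label `∂_k F_a = α ζ_k y_a + β (∂_k y)_a` and, inside one regime (`lip`), `∂_k∂_l F_a = P_kl y_a + α(ζ_k(∂_l y)_a + ζ_l(∂_k y)_a) + β(∂_k∂_l y)_a`
(`P_kl = (α′/ρ)ζ_kζ_l + αν_kl` = the record's `pt` table).  Along the graph segment `δ(s) = s·(t, At)`:
`F_a(x) − F_a(x_c) = Σ_{b lip} [JF^c_{b,a·}·t + ∫∫ F_b″[δ,δ]] + Σ_{b ¬lip} ∫ ∂F_b δ`, hence
`|F_a| ≤ |F_a^c|↑ + Σ_e |Σ_{b lip} JF^c_{b,ae}|↑ w_e + Σ_{b ¬lip} Σ_e |JF^{box}_{b,ae}|↑ w_e + ½ Σ_{b lip} Σ_{kl} |∂_k∂_lF_{b,a}|^{box}↑ |δ_k||δ_l|`,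
`JF_{ae} = ∂_eF_a + Σ_m ∂_{6+m}F_a A_me` — the POINT Jacobian is summed over the Lipschitz-class labels BEFORE the absolute value (it vanishes at the centre when
`A = dξ̂/dU`), the remainder is label-wise. -/

/-- Per-label `y`-space force Jacobian entry `∂_k F_a = α ζ_k y_a + β (∂_k y)_a` from a derivative record. -/
def dF (R : DRec) (a : Fin 3) (k : ℕ) : FI := (R.co.al.mul ((R.z k).mul (R.y a))).add (R.co.be.mul (R.d k a.val))

/-- Per-label second derivative `∂_k∂_l F_a = P_kl y_a + α (ζ_k (∂_l y)_a + ζ_l (∂_k y)_a) + β (∂_k∂_l y)_a`. -/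
def ddF (R : DRec) (a : Fin 3) (k l : ℕ) : FI :=
  (((R.pt.getD (sIx k l) fi0).mul (R.y a)).add (R.co.al.mul (((R.z k).mul (R.d l a.val)).add ((R.z l).mul (R.d k a.val))))).add
    (R.co.be.mulInt (d2 k l a))

/-- Per-label graph-combined Jacobian entry `JF_{ae} = ∂_eF_a + Σ_m ∂_{6+m}F_a·A_me` (`e < 6`). -/
def jF (aP : Fin 3 → Fin 6 → ℤ) (R : DRec) (a : Fin 3) (e : ℕ) : FI :=
  (List.range 3).foldl (fun s m => s.add ((dF R a (6 + m)).mul (aFI aP m e))) (dF R a e)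

/-- Accumulator of the second-order slope enclosure: guard, point force `F^c` (3), summed point Jacobian of the Lipschitz-class labels (`3 × 6`), the
value-hull first-order part of the other labels (3, units `SC²`), the second-order remainder numerator (3, units `SC³`). -/
structure AccS where
  /-- dispatch guard -/
  ok : Bool
  /-- `F(x_c)` -/
  fc : Array FI
  /-- `Σ_{b lip} JF^c_b` row-major `3 × 6` -/
  jc : Array FI
  /-- `Σ_{b ¬lip} Σ_e |JF^{box}_{b,ae}|↑ w_e` -/
  hp : Array ℤ
  /-- `Σ_{b lip} Σ_{kl} |∂_k∂_lF_{b,a}|^{box}↑ wf_k wf_l` (ordered pairs) -/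
  rp : Array ℤ

/-- ★ One label of the slope accumulator (`Rp` = point record, `Rb` = box record on the track product box, `wf` = folded widths incl. the drift slots). -/
def accSlope (aP : Fin 3 → Fin 6 → ℤ) (wf : Array ℤ) (Rp Rb : DRec) (A : AccS) : AccS :=
  let fc := Array.ofFn fun a : Fin 3 => (A.fc.getD a.val fi0).add (Rp.co.be.mul (Rp.y a))
  if Rb.co.lip then
    let jc := Array.ofFn fun n : Fin 18 => (A.jc.getD n.val fi0).add (jF aP Rp ⟨n.val / 6, by omega⟩ (n.val % 6))
    let rp := Array.ofFn fun a : Fin 3 => A.rp.getD a.val 0 +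
      (List.range 9).foldl (fun s k => (List.range 9).foldl (fun s2 l =>
        if l < k then s2 else s2 + (if k = l then 1 else 2) * ((ddF Rb a k l).absHi * wf.getD k 0 / (SC : ℤ)) * wf.getD l 0) s) 0
    ⟨A.ok, fc, jc, A.hp, rp⟩
  else
    let hp := Array.ofFn fun a : Fin 3 => A.hp.getD a.val 0 + (List.range 6).foldl (fun s e => s + (jF aP Rb a e).absHi * wf.getD e 0) 0
    ⟨A.ok, fc, A.jc, hp, A.rp⟩

/-- ★★ **THE SECOND-ORDER SLOPE REPORT AT THE TRACK** `t2SlopeT2 c w aP = (flag, (G₀, G₁, G₂), (f₀, f₁, f₂), (j₀, j₁, j₂), (h₀, h₁, h₂), (r₀, r₁, r₂))` in `SC`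
units: `G_a = f_a + j_a + h_a + r_a ≥ sup_box |F_a(U, σU)|·SC` with `f` the point force, `j = ⌈Σ_e |Σ_{lip} JF^c_{ae}| w_e / SC⌉` (cancelling first order),
`h` the value-hull first-order part of the junction-class labels, `r = ⌈remainder/(2·SC)⌉`; `‖G‖₂/SC` is the `hslope` constant (no `4/3`). -/
def t2SlopeT2 (c w : (Fin 3 × Fin 3) ⊕ Fin 3 → ℤ) (aP : Fin 3 → Fin 6 → ℤ) :
    Bool × (ℤ × ℤ × ℤ) × (ℤ × ℤ × ℤ) × (ℤ × ℤ × ℤ) × (ℤ × ℤ × ℤ) × (ℤ × ℤ × ℤ) :=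
  let w' := trackW aP w
  let LB := nearB c w'
  let wf : Array ℤ := Array.ofFn fun p : Fin 9 => foldW w' p
  let EF := boxE c w'
  let XF := shufFI c w'
  let EP := cenE c
  let XP := cenX c
  let A0 : AccS := ⟨true, zeroArr 3, zeroArr 18, Array.replicate 3 0, Array.replicate 3 0⟩
  let A := LB.foldl (fun A b =>
    match mkDRec 9 EP (qB XP b), mkDRec 9 EF (qB XF b) with
    | some Rp, some Rb => accSlope aP wf Rp Rb A
    | _, _ => ⟨false, A.fc, A.jc, A.hp, A.rp⟩) A0
  let f := fun (a : ℕ) => (A.fc.getD a fi0).absHi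
  let j := fun (a : ℕ) => cdiv ((List.range 6).foldl (fun s e => s + (A.jc.getD (6 * a + e) fi0).absHi * wf.getD e 0) 0) (SC : ℤ)
  let h := fun (a : ℕ) => cdiv (A.hp.getD a 0) (SC : ℤ)
  let r := fun (a : ℕ) => cdiv (A.rp.getD a 0) (2 * (SC : ℤ))
  let G := fun (a : ℕ) => f a + j a + h a + r a
  (A.ok, (G 0, G 1, G 2), (f 0, f 1, f 2), (j 0, j 1, j 2), (h 0, h 1, h 2), (r 0, r 1, r 2))

end Summit.AtomisticToContinuum.Crystallization.Theorems.FrustratedLawDichotomyStrainedPatchHomValueT2Kit
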